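import Summits.ValiantsHypothesis.ValiantsHypothesis.Theorems.LacunarySymmetroidMatrixDescartesCensusDoorA34SheetHyperbolicGraft

/-!
# `MatrixDescartes` census — DOOR A at `(3,4)`: the hyperbolic cell near the closed sub-stratum — the POLARISED ISOTROPY IDENTITY
# `|k|⁴·vᵀadj(M)w = (kᵀMk)·((w×k)ᵀM(v×k)) − (kᵀM(v×k))·((w×k)ᵀMk)` and the FACTORISATION of the middle window at an isotropic kernel vector

HONEST FRAMING.  Object-search cell `pub-symmetroid`, engine seat `val-sym-eng-2` (g7); helper row beside the registered strata line
`Cruxes/DoorA34/Lines/strata.lean` on stmt-ValiantsHypothesis-19980 (`DoorA34 = PosRootLawAt 3 4 18`: OPEN, typed, never asserted here), stub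
`stub_nullTopCeiling`, INDEFINITE cell, continuing …SheetHyperbolicGraft (top letter `S₃ = h·(vwᵀ + wvᵀ)`, `k = v × w`, middle window
`2h·vᵀadj(G)w`, top window `−h²·kᵀGk`).  The closed sub-stratum of the sheet is `tr(adj S₃·S₂) = 0`, i.e. `kᵀS₂k = 0`
(`Census.posRoots_le_17_of_nullTop_of_trace_adjugate_eq_zero`, p575885); this file types what the middle window looks like when `k` is isotropic
for a core letter (all `3 × 3` matrices over a commutative ring unless said otherwise):

* `normSq_sq_mul_adjugate_bilin_eq` — **POLARISED ISOTROPY IDENTITY**: `(k·k)²·(vᵀ adj(M) w) = (kᵀMk)·((w×k)ᵀ M (v×k)) − (kᵀ M (v×k))·((w×k)ᵀ M k)`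
  (the bilinear adjugate form written between the bases `(k, v×k)` of `v^⊥` and `(k, w×k)` of `w^⊥`; `v = w` is …HyperbolicGraft's
  `normSq_sq_mul_quadForm_adjugate_eq`).
* `adjugate_bilin_factor_of_isotropic` — **FACTORISATION**: if `kᵀMk = 0` then `(k·k)²·(vᵀ adj(M) w) = −(kᵀ M (v×k))·((w×k)ᵀ M k)` — a PRODUCT of two
  forms LINEAR in `M`.  For the core pencil `G(x) = Σ_{l<3} x^{d_l} S_l` with `kᵀS_lk = 0` for all three letters (the sub-sub-stratum where the top
  window vanishes identically) the middle window is therefore `−(2h/|k|⁴)·A(x)·B(x)` with `A`, `B` TRINOMIALS (`≤ 2 + 2 = 4` positive roots): the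
  exact skeleton of the located reading «near a common isotropic direction of the core letters the middle window is a perturbed product of two
  trinomials» (seat report HOME/DOOR-A34-ENG2G7-REPORT.md, mechanism II).
* `adjugate_quadForm_eq_neg_sq_of_isotropic` — diagonal case for symmetric `M`: `kᵀMk = 0 ⇒ (k·k)²·(wᵀ adj(M) w) = −(kᵀ M (w×k))²` (the explicit
  square behind …HyperbolicGraft's ISOTROPY LAW `q_w ≤ 0`).
* `hyperbolic_sheet_identity_at_middle_root` — at a zero of the middle form (`vᵀ adj(M) w = 0`) the sheet identity reads
  `T·det(M + h·(vwᵀ + wvᵀ)) = q_v·q_w − h²·T²`; so `q_v·q_w < h²T² ⇒ T·det < 0` (`det_hyperbolic_sign_at_middle_root`): at an exact zero of the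
  middle window the grafted determinant has the sign of `−T` unless the two rank-one compressions dominate the top term.

Nothing here bounds anything; `DoorA34` and the three stubs stay OPEN; registers unchanged; nothing on `MatrixDescartes` (stmt-ValiantsHypothesis-18050)
or `VP ≠ VNP` — VP≠VNP not moved.  [folklore] `2 × 2` minors of the adjugate of a `3 × 3` matrix (`adj(adj M) = det M · M`), cross-product bases; `ring`.
-/

-- `Summit.ValiantsHypothesis.ValiantsHypothesis.…` repeats a component by the D-0017 layout
-- (single-conjunct summit), which the `dupNamespace` linter flags; the name is mandated.
set_option linter.dupNamespace false

namespace Summit.ValiantsHypothesis.ValiantsHypothesis.Theorems.LacunarySymmetroidMatrixDescartes.Census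

open scoped BigOperators Matrix
open Matrix

/-- **POLARISED ISOTROPY IDENTITY**: with `k = v × w`,
`(k·k)²·(vᵀ adj(M) w) = (kᵀMk)·((w×k)ᵀ M (v×k)) − (kᵀ M (v×k))·((w×k)ᵀ M k)`. [folklore] -/
theorem normSq_sq_mul_adjugate_bilin_eq {R : Type*} [CommRing R] (M : Matrix (Fin 3) (Fin 3) R) (v w : Fin 3 → R) :
    ((v ⨯₃ w) ⬝ᵥ (v ⨯₃ w)) ^ 2 * (v ⬝ᵥ (M.adjugate *ᵥ w))
      = ((v ⨯₃ w) ⬝ᵥ (M *ᵥ (v ⨯₃ w))) * ((w ⨯₃ (v ⨯₃ w)) ⬝ᵥ (M *ᵥ (v ⨯₃ (v ⨯₃ w))))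
        - ((v ⨯₃ w) ⬝ᵥ (M *ᵥ (v ⨯₃ (v ⨯₃ w)))) * ((w ⨯₃ (v ⨯₃ w)) ⬝ᵥ (M *ᵥ (v ⨯₃ w))) := by
  simp only [Matrix.adjugate_fin_three, Matrix.mulVec, dotProduct, Fin.sum_univ_three, Matrix.of_apply, Matrix.cons_val', Matrix.cons_val_zero,
    Matrix.cons_val_one, Matrix.head_cons, Matrix.cons_val_two, Matrix.tail_cons, Matrix.empty_val', Matrix.cons_val_fin_one, Matrix.head_fin_const,
    cross_apply]
  ring

/-- **FACTORISATION AT AN ISOTROPIC KERNEL VECTOR**: if `kᵀMk = 0` (`k = v × w`) then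
`(k·k)²·(vᵀ adj(M) w) = −(kᵀ M (v×k))·((w×k)ᵀ M k)` — the middle form is a product of two forms linear in `M`. [folklore] -/
theorem adjugate_bilin_factor_of_isotropic {R : Type*} [CommRing R] (M : Matrix (Fin 3) (Fin 3) R) (v w : Fin 3 → R)
    (hiso : (v ⨯₃ w) ⬝ᵥ (M *ᵥ (v ⨯₃ w)) = 0) :
    ((v ⨯₃ w) ⬝ᵥ (v ⨯₃ w)) ^ 2 * (v ⬝ᵥ (M.adjugate *ᵥ w))
      = -(((v ⨯₃ w) ⬝ᵥ (M *ᵥ (v ⨯₃ (v ⨯₃ w)))) * ((w ⨯₃ (v ⨯₃ w)) ⬝ᵥ (M *ᵥ (v ⨯₃ w)))) := by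
  rw [normSq_sq_mul_adjugate_bilin_eq, hiso, zero_mul, zero_sub]

/-- Diagonal case, symmetric `M`: `kᵀMk = 0 ⇒ (k·k)²·(wᵀ adj(M) w) = −(kᵀ M (w×k))²` (the explicit square behind the ISOTROPY LAW). [folklore] -/
theorem adjugate_quadForm_eq_neg_sq_of_isotropic {R : Type*} [CommRing R] (M : Matrix (Fin 3) (Fin 3) R) (hM : M.IsSymm) (v w : Fin 3 → R)
    (hiso : (v ⨯₃ w) ⬝ᵥ (M *ᵥ (v ⨯₃ w)) = 0) :
    ((v ⨯₃ w) ⬝ᵥ (v ⨯₃ w)) ^ 2 * (w ⬝ᵥ (M.adjugate *ᵥ w)) = -((v ⨯₃ w) ⬝ᵥ (M *ᵥ (w ⨯₃ (v ⨯₃ w)))) ^ 2 := by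
  have h10 : M 1 0 = M 0 1 := by simpa using congrFun (congrFun hM 0) 1
  have h20 : M 2 0 = M 0 2 := by simpa using congrFun (congrFun hM 0) 2
  have h21 : M 2 1 = M 1 2 := by simpa using congrFun (congrFun hM 1) 2
  have hid := normSq_sq_mul_quadForm_adjugate_eq M v w
  have hsym : (w ⨯₃ (v ⨯₃ w)) ⬝ᵥ (M *ᵥ (v ⨯₃ w)) = (v ⨯₃ w) ⬝ᵥ (M *ᵥ (w ⨯₃ (v ⨯₃ w))) := by
    simp only [Matrix.mulVec, dotProduct, Fin.sum_univ_three, cross_apply, h10, h20, h21]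
    ring
  rw [hiso, zero_mul, zero_sub, hsym, ← sq] at hid
  exact hid

/-- **The sheet identity at a zero of the middle form**: if `vᵀ adj(M) w = 0` then `T·det(M + h·(vwᵀ + wvᵀ)) = q_v·q_w − h²·T²`
(symmetric `M`; `T = kᵀMk`). [folklore] -/
theorem hyperbolic_sheet_identity_at_middle_root (M : Matrix (Fin 3) (Fin 3) ℝ) (hM : M.IsSymm) (h : ℝ) (v w : Fin 3 → ℝ)
    (hmid : v ⬝ᵥ (M.adjugate *ᵥ w) = 0) :
    ((v ⨯₃ w) ⬝ᵥ (M *ᵥ (v ⨯₃ w))) * (M + h • (Matrix.vecMulVec v w + Matrix.vecMulVec w v)).det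
      = (v ⬝ᵥ (M.adjugate *ᵥ v)) * (w ⬝ᵥ (M.adjugate *ᵥ w)) - h ^ 2 * ((v ⨯₃ w) ⬝ᵥ (M *ᵥ (v ⨯₃ w))) ^ 2 := by
  rw [hyperbolic_sheet_identity M hM h v w, hmid]
  ring

/-- **Sign of the grafted determinant at a zero of the middle window**: if `vᵀ adj(M) w = 0` and the two rank-one compressions do not dominate the
top term (`q_v·q_w < h²·T²`), then `T·det(M + h·(vwᵀ + wvᵀ)) < 0` — the determinant has the sign of `−T` there. [folklore] -/
theorem det_hyperbolic_sign_at_middle_root (M : Matrix (Fin 3) (Fin 3) ℝ) (hM : M.IsSymm) (h : ℝ) (v w : Fin 3 → ℝ)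
    (hmid : v ⬝ᵥ (M.adjugate *ᵥ w) = 0)
    (hdom : (v ⬝ᵥ (M.adjugate *ᵥ v)) * (w ⬝ᵥ (M.adjugate *ᵥ w)) < h ^ 2 * ((v ⨯₃ w) ⬝ᵥ (M *ᵥ (v ⨯₃ w))) ^ 2) :
    ((v ⨯₃ w) ⬝ᵥ (M *ᵥ (v ⨯₃ w))) * (M + h • (Matrix.vecMulVec v w + Matrix.vecMulVec w v)).det < 0 := by
  rw [hyperbolic_sheet_identity_at_middle_root M hM h v w hmid]
  linarith

/-- Companion: if instead the compressions dominate (`h²·T² < q_v·q_w`), the grafted determinant has the sign of `+T` at the middle zero. [folklore] -/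
theorem det_hyperbolic_sign_at_middle_root' (M : Matrix (Fin 3) (Fin 3) ℝ) (hM : M.IsSymm) (h : ℝ) (v w : Fin 3 → ℝ)
    (hmid : v ⬝ᵥ (M.adjugate *ᵥ w) = 0)
    (hdom : h ^ 2 * ((v ⨯₃ w) ⬝ᵥ (M *ᵥ (v ⨯₃ w))) ^ 2 < (v ⬝ᵥ (M.adjugate *ᵥ v)) * (w ⬝ᵥ (M.adjugate *ᵥ w))) :
    0 < ((v ⨯₃ w) ⬝ᵥ (M *ᵥ (v ⨯₃ w))) * (M + h • (Matrix.vecMulVec v w + Matrix.vecMulVec w v)).det := by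
  rw [hyperbolic_sheet_identity_at_middle_root M hM h v w hmid]
  linarith

end Summit.ValiantsHypothesis.ValiantsHypothesis.Theorems.LacunarySymmetroidMatrixDescartes.Census
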